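import Summits.ABC.IUTFork.DAGC312p
import Summits.ABC.IUTFork.Cor312EtaleLedger

/-!
# Kernel DAG index — layer C312, part za: knitting DELTA 14 — the one undischarged node is exactly the node at which TEAM C's
identification-of-copies ledger draws the set-level identification (cross-team kernel check, BY NAME)

index v1 · abc-iut-c312-2 (filer, gen 3). PROOF-ONLY, APPEND-ONLY (imports part p and TEAM C's row C-2 file `Cor312EtaleLedger`, abc-iut-c312-13,
which is built over c312-2's `Cor312Steps` alone — neutral w.r.t. the co-import breaker B1).

Two censuses of the twenty printed nodes of the proof of [IUTchIII] Cor. 3.12 were made independently: TEAM C's `Cor312Proof.Step.idents`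
assigns to each node the KINDS OF IDENTIFICATION OF COPIES it performs (`Ident`: full-poly gluings, label identifications, volume invariance,
…, and `setLevelInclusion` — the set-level identification «`−|log(q)| ∈ ℝ_{≤ −|log(Θ)|}`»), with `setLevel_only_at_xi_f : setLevelInclusion ∈
s.idents ↔ s = xi_f` (by `decide` over the landed citation data); part p discharged, under the readings of record, every node EXCEPT (xi-f)
(sixteen outright, three under named side data of the instantiation). This part records the coincidence as one kernel statement:

* `holds_of_ne_xi_f` — uniform form of part p: for every step `s ≠ xi_f`, `s.Holds (lociReadingI S pending) (obsReadingA S pending P D)` given the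
  named side data (coarse-volume properties of `S.D P.n`, strip-iso nonemptiness, `ThetaFinite`, `AbsLogQPos`);
* `xi_f_is_the_setLevel_node` — (TEAM C) the set-level identification is drawn at (xi-f) and nowhere else ∧ (index) every other node holds at
  the readings of record ∧ (part p) at (xi-f) the node is the typed Statement.
Neutral: it locates, it does not judge. THIS FILE PROVES NOTHING NEW about [IUTchIII] §3 AND ASSERTS NOTHING; no side taken on Cor. 3.12.
typed ≠ discharged; indexed ≠ endorsed. [claim: Mochizuki2012, status: disputed]
-/

noncomputable section

namespace Summit.ABC.IUTFork.DAG

open Cor312Proof Thm311 Literature.IUT.LogThetaLattice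

variable {T : ThetaIndex} (S : FullSituation T) (pending : Locus → Prop) (P : Cor312.Setting S.toSituation)
  (D : ThetaLinkStrips P.LogLink P.Strip)

/-- **Every step node other than (xi-f) holds under the readings of record**, given the named side data (uniform form of part p's
nineteen discharges). [claim: Mochizuki2012, status: disputed] -/
theorem holds_of_ne_xi_f (s : Step) (hs : s ≠ .xi_f)
    (hIndAdm : ∀ Φ ∈ S.L.Ind1Family ∪ S.L.Ind2Family, ∀ (j : T.Label) (vQ : T.VQ) (A : Set (S.L.Packet j vQ)),
      (S.D P.n).Adm j vQ A ↔ (S.D P.n).Adm j vQ (Φ j vQ '' A))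
    (hIndVol : (S.D P.n).LogvolInvariant)
    (hMono : ∀ (j : T.Label) (vQ : T.VQ) (A B : Set (S.L.Packet j vQ)),
      (S.D P.n).Adm j vQ A → (S.D P.n).Adm j vQ B → A ⊆ B → (S.D P.n).logvol j vQ A ≤ (S.D P.n).logvol j vQ B)
    (hNE : ∀ n m : ℤ, Nonempty (P.IsoS (D.stripLGP (P.lattice.logLink n (m - 1))) (D.stripDelta (P.lattice.theater (n + 1) m))))
    (hfin : P.ThetaFinite) (hqpos : P.AbsLogQPos) :
    s.Holds (lociReadingI S pending) (obsReadingA S pending P D) := by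
  cases s
  case xi_f => exact absurd rfl hs
  case wlog => exact N_IUTchIII_Cor3_12_pf_WLOG_holds S pending P D
  case i => exact N_IUTchIII_Cor3_12_pf_i_holds S pending P D
  case ii => exact N_IUTchIII_Cor3_12_pf_ii_holds S pending P D
  case iii => exact N_IUTchIII_Cor3_12_pf_iii_holds S pending P D
  case iv => exact N_IUTchIII_Cor3_12_pf_iv_holds S pending P D
  case v => exact N_IUTchIII_Cor3_12_pf_v_holds S pending P D
  case vi => exact N_IUTchIII_Cor3_12_pf_vi_holds S pending P D
  case vii => exact N_IUTchIII_Cor3_12_pf_vii_holds S pending P D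
  case viii => exact N_IUTchIII_Cor3_12_pf_viii_holds S pending P D
  case ix => exact N_IUTchIII_Cor3_12_pf_ix_holds S pending P D
  case x => exact N_IUTchIII_Cor3_12_pf_x_holds_of S pending P D hIndAdm hIndVol hMono
  case xi_a => exact N_IUTchIII_Cor3_12_pf_xi_a_holds_of S pending P D hNE
  case xi_b => exact N_IUTchIII_Cor3_12_pf_xi_b_holds S pending P D
  case xi_c => exact N_IUTchIII_Cor3_12_pf_xi_c_holds S pending P D
  case xi_d => exact N_IUTchIII_Cor3_12_pf_xi_d_holds_of S pending P D hfin hqpos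
  case xi_e => exact N_IUTchIII_Cor3_12_pf_xi_e_holds S pending P D
  case xi_g => exact N_IUTchIII_Cor3_12_pf_xi_g_holds S pending P D
  case xi_h => exact N_IUTchIII_Cor3_12_pf_xi_h_holds S pending P D
  case xii => exact N_IUTchIII_Cor3_12_pf_xii_holds S pending P D

/-- **THE ONE UNDISCHARGED NODE IS EXACTLY TEAM C's SET-LEVEL NODE.** (a) TEAM C's ledger (`setLevel_only_at_xi_f`, by `decide`): the set-level
identification of copies is drawn at (xi-f) and at no other node; (b) the index: every other node holds at the readings of record given the named
side data; (c) part p: at (xi-f), given `ThetaFinite` and `AbsLogQPos`, the node IS the typed Statement. Cross-team kernel check; locates,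
does not judge. [claim: Mochizuki2012, status: disputed] -/
theorem xi_f_is_the_setLevel_node
    (hIndAdm : ∀ Φ ∈ S.L.Ind1Family ∪ S.L.Ind2Family, ∀ (j : T.Label) (vQ : T.VQ) (A : Set (S.L.Packet j vQ)),
      (S.D P.n).Adm j vQ A ↔ (S.D P.n).Adm j vQ (Φ j vQ '' A))
    (hIndVol : (S.D P.n).LogvolInvariant)
    (hMono : ∀ (j : T.Label) (vQ : T.VQ) (A B : Set (S.L.Packet j vQ)),
      (S.D P.n).Adm j vQ A → (S.D P.n).Adm j vQ B → A ⊆ B → (S.D P.n).logvol j vQ A ≤ (S.D P.n).logvol j vQ B)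
    (hNE : ∀ n m : ℤ, Nonempty (P.IsoS (D.stripLGP (P.lattice.logLink n (m - 1))) (D.stripDelta (P.lattice.theater (n + 1) m))))
    (hfin : P.ThetaFinite) (hqpos : P.AbsLogQPos) :
    (∀ s ∈ Step.all, Ident.setLevelInclusion ∈ s.idents ↔ s = .xi_f) ∧
    (∀ s : Step, s ≠ .xi_f → s.Holds (lociReadingI S pending) (obsReadingA S pending P D)) ∧
    (N_IUTchIII_Cor3_12_pf_xi_f (lociReadingI S pending) (obsReadingA S pending P D) ↔ P.Statement) :=
  ⟨setLevel_only_at_xi_f, fun s hs => holds_of_ne_xi_f S pending P D s hs hIndAdm hIndVol hMono hNE hfin hqpos,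
    N_IUTchIII_Cor3_12_pf_xi_f_iff_statement S pending P D hfin hqpos⟩

end Summit.ABC.IUTFork.DAG

end
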